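import Literature.Analysis.FluidPDE.CollisionalTransfer
import Literature.Analysis.FluidPDE.HardSphereFlowJointMeasurable
import Literature.Analysis.FluidPDE.HardSphereTrajectoryMeasurable
import Literature.Analysis.FunctionSpaces.TorusCalculusProofs
import Literature.Analysis.FunctionSpaces.TorusEnstrophyOrthogonality
import Literature.MathematicalPhysics.KineticTheory.HardSphereEulerProofs
import Summits.AtomisticToContinuum.HydrodynamicLimit.Theorems.RelayRaceLocalityRestartPrincipleMeanClosureTools
import Summits.AtomisticToContinuum.HydrodynamicLimit.Theorems.CollisionIsometryCLTMesoscopicLLNKernels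
import HarnessLib

/-!
# Crux `MeanFluxClosure` (stmt-AtomisticToContinuum-9256), line `registered` — stub KS-a:
# the streaming-stress mollification commutator

Support file (`--supports stmt-AtomisticToContinuum-9256`) proving the stub
`stub_streamingStressCommutator` of the lead's reshaped skeleton of
`Summit.AtomisticToContinuum.HydrodynamicLimit.Theses.AnnealedZeroHorizon.MeanFluxClosure`
(route AnnealedZeroHorizon). With `c = (N+1)⁻¹`, the functional

`D(z) = c ∫_{t₁}^{t₂} Σ_a ⟪Dφ(x_a(s)) v_a(s), v_a(s)⟫ ds
        − ∫_{t₁}^{t₂} ∫_x c Σ_a k(x − x_a(s)) Σ_ij v_a^i(s) v_a^j(s) ∂_jφ_i(x) dx ds`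

(kinetic stress tested with `∇φ` AT the particles minus the `k`-MOLLIFIED kinetic stress tested with
`∇φ`) is integrable under the local Gibbs law `localGibbsLaw σ a₀ u₀ θ₀ N (Φ N)` with
`|E D| ≤ ε`, for every `N`, as soon as the continuous probability kernel `k` is supported in a
minimal-image ball of radius `ℓ = ℓ(φ, ε, t₂ − t₁, θ₀, u₀)`.

Proof (deterministic, EOS-free):
* `⟪Dφ(x) v, v⟫ = Σ_ij v_i v_j ∂_jφ_i(x)` (`Torus.fderiv_apply_eq_sum_partialDeriv`,
  `Torus.fderiv_apply_coord`), and the space integral commutes with the finite sums, so pointwise in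
  the configuration the integrand of `D` is `c Σ_a Σ_ij v_a^i v_a^j [∂_jφ_i(x_a) − ∫ k(x − x_a)∂_jφ_i(x) dx]`;
* uniform continuity of the nine partial derivatives in the minimal-image distance
  (`MesoLLN.exists_forall_euclidDist_lt_norm_sub_lt`) and the mollification estimate
  `MesoLLN.abs_integral_translate_mul_sub_le` give `|∂_jφ_i(p) − ∫ k(x − p)∂_jφ_i(x) dx| ≤ η` once
  `supp k ⊂ B_ℓ`, whence `|integrand| ≤ 9η c Σ_a ‖v_a(s)‖² = 9η c Σ_a ‖v_a(0)‖²` on the good set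
  (energy conservation, `sum_norm_sq_vel_flow`), and `|D z| ≤ 9η (t₂ − t₁) c Σ_a ‖v_a(0)‖²`
  (the time integrals split: the streaming term is interval integrable by
  `HardSphereFlow.momentumObservable_sub_eq_torus`, the difference is a continuous observable —
  parametric integral over the compact torus — along a measurable trajectory, and bounded);
* `z ↦ c Σ_a ‖v_a‖²` is integrable with mean `≤ 3 sup θ₀ + sup ‖u₀‖²` under the local Gibbs law
  (`integrable_avg_norm_sq_vel_flow`, `lintegral_avg_norm_sq_vel_le`; probability measure for
  `σ ≤ 1/2`), `D` is a.e.-strongly measurable (`HardSphereFlow.aemeasurable_intervalIntegral_comp_flow_torus`,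
  good set conull by absolute continuity), so `Integrable D` and `|E D| ≤ 9η(t₂ − t₁)(3 sup θ₀ + sup‖u₀‖²) ≤ ε`
  for `η := ε / (9 (t₂ − t₁ + 1)(3 sup θ₀ + sup‖u₀‖² + 1))`; `σ₀ := 1/2`.

No definitions. References: H. Spohn, *Large Scale Dynamics of Interacting Particles* (1991),
Part I §2.3, Ch. 3 (kinetic part of the momentum current (3.7)).
-/

noncomputable section

namespace Summit.AtomisticToContinuum.HydrodynamicLimit.Theorems

open scoped BigOperators ENNReal Topology InnerProductSpace
open MeasureTheory Set Filter
open Literature.Analysis.FluidPDE Literature.Analysis.FunctionSpaces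
open Literature.MathematicalPhysics.KineticTheory

namespace StreamingStressCommutator

/-- The quadratic form of the torus derivative of a smooth field in coordinates:
`⟪Dφ(x) v, v⟫ = Σᵢⱼ vᵢ vⱼ ∂ⱼφᵢ(x)`. [folklore] -/
theorem inner_fderiv_eq_sum {φ : T3 → V3} (hφ : Torus.IsSmooth φ) (x : T3) (v : V3) :
    ⟪Torus.fderiv φ x v, v⟫_ℝ = ∑ i, ∑ j, v i * v j * Torus.partialDeriv j (fun y => φ y i) x := by
  have h1 : Torus.IsContDiff 1 φ := hφ.isContDiff (by simp)
  have hcoord : ∀ i, (Torus.fderiv φ x v) i =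
      ∑ j, v j * Torus.partialDeriv j (fun y => φ y i) x := by
    intro i
    have hi : Torus.IsContDiff 1 (fun y => φ y i) := (hφ.apply i).isContDiff (by simp)
    rw [← Torus.fderiv_apply_coord h1 x v i, Torus.fderiv_apply_eq_sum_partialDeriv hi x v]
    simp [smul_eq_mul]
  simp only [PiLp.inner_apply, RCLike.inner_apply, conj_trivial, hcoord]
  refine Finset.sum_congr rfl fun i _ => ?_
  rw [Finset.mul_sum]
  refine Finset.sum_congr rfl fun j _ => ?_
  ring

/-- The streaming momentum flux in coordinates: `Σ_a ⟪Dφ(x_a) v_a, v_a⟫ = Σ_a Σᵢⱼ v_aᵢ v_aⱼ ∂ⱼφᵢ(x_a)`.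
[folklore] -/
theorem momentumStreaming_eq_sum {n : ℕ} {φ : T3 → V3} (hφ : Torus.IsSmooth φ)
    (w : Config n (Fin 3) T3) :
    momentumStreaming φ w =
      ∑ a, ∑ i, ∑ j, (w a).2 i * (w a).2 j * Torus.partialDeriv j (fun y => φ y i) (w a).1 := by
  unfold momentumStreaming
  exact Finset.sum_congr rfl fun a _ => inner_fderiv_eq_sum hφ _ _

/-- Partial derivatives of the coordinates of a smooth field are continuous. [folklore] -/
theorem continuous_partialDeriv_apply {φ : T3 → V3} (hφ : Torus.IsSmooth φ) (i j : Fin 3) :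
    Continuous (Torus.partialDeriv j (fun y => φ y i)) :=
  ((hφ.apply i).partialDeriv j).continuous

/-- Swapping the space integral with the finite sums: the `k`-mollified kinetic stress tested
with `∇φ` is `c Σ_a Σᵢⱼ v_aᵢ v_aⱼ ∫ k(x − x_a) ∂ⱼφᵢ(x) dx`. [folklore] -/
theorem integral_mollifiedStress_eq_sum {n : ℕ} {φ : T3 → V3} (hφ : Torus.IsSmooth φ)
    {k : T3 → ℝ} (hk : Continuous k) (c : ℝ) (w : Config n (Fin 3) T3) :
    (∫ x, c * ∑ a, k (x - (w a).1) * (∑ i, ∑ j, (w a).2 i * (w a).2 j *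
        Torus.partialDeriv j (fun y => φ y i) x)) =
      ∑ a, ∑ i, ∑ j, c * ((w a).2 i * (w a).2 j) *
        ∫ x, k (x - (w a).1) * Torus.partialDeriv j (fun y => φ y i) x := by
  have hP := continuous_partialDeriv_apply hφ
  have hpt : ∀ x, c * ∑ a, k (x - (w a).1) * (∑ i, ∑ j, (w a).2 i * (w a).2 j *
      Torus.partialDeriv j (fun y => φ y i) x) =
      ∑ a, ∑ i, ∑ j, c * ((w a).2 i * (w a).2 j) *
        (k (x - (w a).1) * Torus.partialDeriv j (fun y => φ y i) x) := by
    intro x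
    simp only [Finset.mul_sum]
    refine Finset.sum_congr rfl fun a _ => Finset.sum_congr rfl fun i _ =>
      Finset.sum_congr rfl fun j _ => ?_
    ring
  simp_rw [hpt]
  have hint : ∀ a i j, Integrable (fun x => c * ((w a).2 i * (w a).2 j) *
      (k (x - (w a).1) * Torus.partialDeriv j (fun y => φ y i) x)) := by
    intro a i j
    refine integrable_of_continuous_T3 ?_
    exact continuous_const.mul ((hk.comp (continuous_id.sub continuous_const)).mul (hP i j))
  rw [integral_finsetSum _ fun a _ => ?_]
  · refine Finset.sum_congr rfl fun a _ => ?_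
    rw [integral_finsetSum _ fun i _ => ?_]
    · refine Finset.sum_congr rfl fun i _ => ?_
      rw [integral_finsetSum _ fun j _ => hint a i j]
      refine Finset.sum_congr rfl fun j _ => ?_
      exact integral_const_mul _ _
    · exact integrable_finsetSum _ fun j _ => hint a i j
  · exact integrable_finsetSum _ fun i _ => integrable_finsetSum _ fun j _ => hint a i j

/-- **Pointwise mollification commutator for the kinetic stress.** If every mollified partial
derivative `∫ k(x − p) ∂ⱼφᵢ(x) dx` is within `η` of `∂ⱼφᵢ(p)`, then for every configuration
`|c K_φ(w) − c Σ_a Σᵢⱼ v_aᵢ v_aⱼ ∫ k(x − x_a)∂ⱼφᵢ| ≤ 9 η c Σ_a ‖v_a‖²`. [folklore] -/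
theorem abs_streaming_sub_mollified_le {n : ℕ} {φ : T3 → V3} (hφ : Torus.IsSmooth φ)
    {k : T3 → ℝ} (hk : Continuous k) {η : ℝ}
    (hη : ∀ i j (p : T3), |(∫ x, k (x - p) * Torus.partialDeriv j (fun y => φ y i) x) -
        Torus.partialDeriv j (fun y => φ y i) p| ≤ η)
    {c : ℝ} (hc : 0 ≤ c) (w : Config n (Fin 3) T3) :
    |c * momentumStreaming φ w -
        ∫ x, c * ∑ a, k (x - (w a).1) * (∑ i, ∑ j, (w a).2 i * (w a).2 j *
          Torus.partialDeriv j (fun y => φ y i) x)| ≤ 9 * η * (c * ∑ a, ‖(w a).2‖ ^ 2) := by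
  rw [integral_mollifiedStress_eq_sum hφ hk c w, momentumStreaming_eq_sum hφ w]
  have hL : c * ∑ a, ∑ i, ∑ j, (w a).2 i * (w a).2 j *
      Torus.partialDeriv j (fun y => φ y i) (w a).1 =
      ∑ a, ∑ i, ∑ j, c * ((w a).2 i * (w a).2 j) *
        Torus.partialDeriv j (fun y => φ y i) (w a).1 := by
    simp only [Finset.mul_sum]
    refine Finset.sum_congr rfl fun a _ => Finset.sum_congr rfl fun i _ =>
      Finset.sum_congr rfl fun j _ => ?_
    ring
  rw [hL, ← Finset.sum_sub_distrib]
  simp_rw [← Finset.sum_sub_distrib, ← mul_sub]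
  have hR : 9 * η * (c * ∑ a, ‖(w a).2‖ ^ 2) = ∑ a, ∑ _i : Fin 3, ∑ _j : Fin 3, c * ‖(w a).2‖ ^ 2 * η := by
    simp only [Finset.sum_const, Finset.card_univ, Fintype.card_fin, Finset.mul_sum]
    refine Finset.sum_congr rfl fun a _ => ?_
    ring
  rw [hR]
  refine (Finset.abs_sum_le_sum_abs _ _).trans (Finset.sum_le_sum fun a _ => ?_)
  refine (Finset.abs_sum_le_sum_abs _ _).trans (Finset.sum_le_sum fun i _ => ?_)
  refine (Finset.abs_sum_le_sum_abs _ _).trans (Finset.sum_le_sum fun j _ => ?_)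
  rw [abs_mul, abs_mul, abs_of_nonneg hc, abs_sub_comm]
  have hvi : ∀ (v : V3) (l : Fin 3), |v l| ≤ ‖v‖ := fun v l => by
    rw [← Real.norm_eq_abs]
    exact PiLp.norm_apply_le v l
  have h1 : |(w a).2 i * (w a).2 j| ≤ ‖(w a).2‖ ^ 2 := by
    rw [abs_mul, sq]
    exact mul_le_mul (hvi _ _) (hvi _ _) (abs_nonneg _) (norm_nonneg _)
  have hη0 : 0 ≤ η := (abs_nonneg _).trans (hη i j (w a).1)
  exact mul_le_mul (mul_le_mul_of_nonneg_left h1 hc) (hη i j (w a).1) (abs_nonneg _)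
    (mul_nonneg hc (sq_nonneg _))

/-- The `k`-mollified kinetic stress tested with `∇φ` is a continuous function of the
configuration (parametric integral of a jointly continuous integrand over the compact torus).
[folklore] -/
theorem continuous_mollifiedStress {n : ℕ} {φ : T3 → V3} (hφ : Torus.IsSmooth φ)
    {k : T3 → ℝ} (hk : Continuous k) (c : ℝ) :
    Continuous fun w : Config n (Fin 3) T3 => ∫ x, c * ∑ a, k (x - (w a).1) *
      (∑ i, ∑ j, (w a).2 i * (w a).2 j * Torus.partialDeriv j (fun y => φ y i) x) := by
  have hP := continuous_partialDeriv_apply hφ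
  have hF : Continuous (Function.uncurry fun (w : Config n (Fin 3) T3) (x : T3) =>
      c * ∑ a, k (x - (w a).1) *
        (∑ i, ∑ j, (w a).2 i * (w a).2 j * Torus.partialDeriv j (fun y => φ y i) x)) := by
    refine continuous_const.mul (continuous_finsetSum _ fun a _ => ?_)
    refine (hk.comp (by fun_prop)).mul (continuous_finsetSum _ fun i _ =>
      continuous_finsetSum _ fun j _ => ?_)
    have hv : Continuous fun p : Config n (Fin 3) T3 × T3 => (p.1 a).2 := by fun_prop
    exact (((PiLp.continuous_apply 2 _ i).comp hv).mul ((PiLp.continuous_apply 2 _ j).comp hv)).mul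
      ((hP i j).comp continuous_snd)
  have h := continuous_parametric_integral_of_continuous (μ := (volume : Measure T3)) hF
    isCompact_univ
  simpa only [Measure.restrict_univ] using h

/-- Along a good orbit the streaming term is interval integrable on every window `[t₁, t₂]`,
`0 ≤ t₁ ≤ t₂` (Literature `HardSphereFlow.momentumObservable_sub_eq_torus` on `[0, t₂]`). [folklore] -/
theorem intervalIntegrable_momentumStreaming_flow {n : ℕ} {ε : ℝ}
    (Φ : HardSphereFlow (Torus.geometry (Fin 3)) ε n) {φ : T3 → V3} (hφ : Torus.IsSmooth φ)
    {z : Config n (Fin 3) T3} (hz : z ∈ Φ.good) {t₁ t₂ : ℝ} (h₁ : 0 ≤ t₁) (h₁₂ : t₁ ≤ t₂) :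
    IntervalIntegrable (fun s => momentumStreaming φ (Φ.flow s z)) volume t₁ t₂ := by
  have h := (Φ.momentumObservable_sub_eq_torus (hφ.isContDiff (by simp)) hz (h₁.trans h₁₂)).1
  refine h.mono_set (uIcc_subset_uIcc ?_ right_mem_uIcc)
  rw [mem_uIcc]
  exact Or.inl ⟨h₁, h₁₂⟩

/-- **Pathwise bound for the streaming-stress commutator over a window.** Along the orbit of a
good datum, `|c ∫ K_φ ds − ∫∫ (mollified stress):∇φ dx ds| ≤ 9 η (t₂ − t₁) c Σ_a ‖v_a(0)‖²`
(pointwise commutator `abs_streaming_sub_mollified_le` integrated in time, energy conservation).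
[folklore] -/
theorem abs_window_commutator_le {n : ℕ} {ε : ℝ}
    (Φ : HardSphereFlow (Torus.geometry (Fin 3)) ε n) {φ : T3 → V3} (hφ : Torus.IsSmooth φ)
    {k : T3 → ℝ} (hk : Continuous k) {η : ℝ}
    (hη : ∀ i j (p : T3), |(∫ x, k (x - p) * Torus.partialDeriv j (fun y => φ y i) x) -
        Torus.partialDeriv j (fun y => φ y i) p| ≤ η)
    {c : ℝ} (hc : 0 ≤ c) {z : Config n (Fin 3) T3} (hz : z ∈ Φ.good) {t₁ t₂ : ℝ} (h₁ : 0 ≤ t₁)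
    (h₁₂ : t₁ ≤ t₂) :
    |c * (∫ s in t₁..t₂, momentumStreaming φ (Φ.flow s z)) -
        ∫ s in t₁..t₂, ∫ x, c * ∑ a, k (x - (Φ.flow s z a).1) *
          (∑ i, ∑ j, (Φ.flow s z a).2 i * (Φ.flow s z a).2 j *
            Torus.partialDeriv j (fun y => φ y i) x)| ≤
      9 * η * (t₂ - t₁) * (c * ∑ a, ‖(z a).2‖ ^ 2) := by
  -- the two observables along the orbit
  set A : ℝ → ℝ := fun s => c * momentumStreaming φ (Φ.flow s z) with hA
  set B : ℝ → ℝ := fun s => ∫ x, c * ∑ a, k (x - (Φ.flow s z a).1) *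
    (∑ i, ∑ j, (Φ.flow s z a).2 i * (Φ.flow s z a).2 j *
      Torus.partialDeriv j (fun y => φ y i) x) with hB
  have hbound : ∀ s, |A s - B s| ≤ 9 * η * (c * ∑ a, ‖(z a).2‖ ^ 2) := by
    intro s
    have h := abs_streaming_sub_mollified_le hφ hk hη hc (Φ.flow s z)
    rwa [sum_norm_sq_vel_flow Φ hz s] at h
  have hAi : IntervalIntegrable A volume t₁ t₂ :=
    (intervalIntegrable_momentumStreaming_flow Φ hφ hz h₁ h₁₂).const_mul c
  -- `A - B` is measurable in time (continuous observable along a measurable trajectory) and bounded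
  have hG : Continuous fun w : Config n (Fin 3) T3 => c * momentumStreaming φ w -
      ∫ x, c * ∑ a, k (x - (w a).1) * (∑ i, ∑ j, (w a).2 i * (w a).2 j *
        Torus.partialDeriv j (fun y => φ y i) x) :=
    (continuous_const.mul (continuous_momentumStreaming (hφ.isContDiff (by simp)))).sub
      (continuous_mollifiedStress hφ hk c)
  have hγ : Measurable fun s => Φ.flow s z := (Φ.isTrajectory z hz).measurable_torus
  have hABm : AEStronglyMeasurable (fun s => A s - B s) (volume.restrict (Set.uIoc t₁ t₂)) :=
    (hG.measurable.comp hγ).aestronglyMeasurable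
  have hABi : IntervalIntegrable (fun s => A s - B s) volume t₁ t₂ := by
    refine IntervalIntegrable.mono_fun' (g := fun _ => 9 * η * (c * ∑ a, ‖(z a).2‖ ^ 2))
      intervalIntegrable_const hABm (ae_of_all _ fun s => ?_)
    show ‖A s - B s‖ ≤ 9 * η * (c * ∑ a, ‖(z a).2‖ ^ 2)
    rw [Real.norm_eq_abs]
    exact hbound s
  have hBi : IntervalIntegrable B volume t₁ t₂ := by
    have hBeq : B = fun s => A s - (A s - B s) := by
      funext s
      ring
    rw [hBeq]
    exact hAi.sub hABi
  have hsplit : c * (∫ s in t₁..t₂, momentumStreaming φ (Φ.flow s z)) - (∫ s in t₁..t₂, B s) =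
      ∫ s in t₁..t₂, (A s - B s) := by
    rw [intervalIntegral.integral_sub hAi hBi, hA, intervalIntegral.integral_const_mul]
  show |c * (∫ s in t₁..t₂, momentumStreaming φ (Φ.flow s z)) - (∫ s in t₁..t₂, B s)| ≤ _
  rw [hsplit]
  have h := intervalIntegral.norm_integral_le_of_norm_le_const (a := t₁) (b := t₂)
    (f := fun s => A s - B s) (C := 9 * η * (c * ∑ a, ‖(z a).2‖ ^ 2)) fun s _ => by
      rw [Real.norm_eq_abs]
      exact hbound s
  rw [Real.norm_eq_abs, abs_of_nonneg (sub_nonneg.2 h₁₂)] at h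
  calc |∫ s in t₁..t₂, (A s - B s)| ≤ 9 * η * (c * ∑ a, ‖(z a).2‖ ^ 2) * (t₂ - t₁) := h
    _ = 9 * η * (t₂ - t₁) * (c * ∑ a, ‖(z a).2‖ ^ 2) := by ring

/-- Components of the matrix of partial derivatives are controlled by its sup norm. [folklore] -/
theorem abs_sub_apply_le_norm_sub (P Q : Fin 3 → Fin 3 → ℝ) (i j : Fin 3) :
    |P i j - Q i j| ≤ ‖P - Q‖ := by
  rw [← Real.norm_eq_abs]
  calc ‖P i j - Q i j‖ = ‖(P - Q) i j‖ := rfl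
    _ ≤ ‖(P - Q) i‖ := norm_le_pi_norm _ j
    _ ≤ ‖P - Q‖ := norm_le_pi_norm _ i

end StreamingStressCommutator

open StreamingStressCommutator in
/-- **Stub KS-a of the `MeanFluxClosure` skeleton (line `registered`): the streaming-stress
mollification commutator closes in mean.** For every smooth vector field `φ` there is `ℓ > 0` such
that for every continuous probability kernel `k` supported in the `ℓ`-ball, for every `N`, the
functional `z ↦ (N+1)⁻¹ ∫_{t₁}^{t₂} Σ_a ⟪Dφ(x_a) v_a, v_a⟫ ds − ∫_{t₁}^{t₂} ∫_x (N+1)⁻¹ Σ_a k(x − x_a)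
Σ_ij v_a^i v_a^j ∂_jφ_i(x) dx ds` is integrable under the local Gibbs law with `|expectation| ≤ ε`.
Proof: uniform continuity of the nine partial derivatives `∂ⱼφᵢ` on the compact torus gives `ℓ` with
`|∂ⱼφᵢ(p) − ∫ k(x − p) ∂ⱼφᵢ(x) dx| ≤ η`; pathwise the functional is then at most
`9η(t₂ − t₁)(N+1)⁻¹Σ_a‖v_a(0)‖²` on the good set (energy conservation), whose mean is at most
`3 sup θ₀ + sup ‖u₀‖²` (Gaussian velocities of the local Gibbs law); `η` is chosen accordingly and
`σ₀ = 1/2` makes the law a probability measure. -/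
theorem stub_streamingStressCommutator : ∀ (a₀ θ₀ : Literature.MathematicalPhysics.KineticTheory.T3 → ℝ) (u₀ : Literature.MathematicalPhysics.KineticTheory.T3 → Literature.MathematicalPhysics.KineticTheory.V3), Continuous a₀ → Continuous θ₀ → Continuous u₀ → (∀ x, 0 < a₀ x) → (∀ x, 0 < θ₀ x) → ∃ σ₀ : ℝ, 0 < σ₀ ∧ ∀ σ : ℝ, 0 < σ → σ < σ₀ → ∀ Φ : (N : ℕ) → Literature.Analysis.FluidPDE.HardSphereFlow (Literature.Analysis.FluidPDE.Torus.geometry (Fin 3)) (Literature.MathematicalPhysics.KineticTheory.hsDiameter σ N) (N + 1), ∀ t₁ t₂ : ℝ, 0 ≤ t₁ → t₁ ≤ t₂ → ∀ ε : ℝ, 0 < ε → (∀ φ : Literature.MathematicalPhysics.KineticTheory.T3 → Literature.MathematicalPhysics.KineticTheory.V3, Literature.Analysis.FunctionSpaces.Torus.IsSmooth φ → ∃ ℓ : ℝ, 0 < ℓ ∧ ∀ k : Literature.MathematicalPhysics.KineticTheory.T3 → ℝ, (Continuous k ∧ (∀ y, 0 ≤ k y) ∧ (∫ y, k y = 1)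 ∧ (∀ y, k y ≠ 0 → Literature.Analysis.FluidPDE.Torus.euclidDist y 0 < ℓ)) → ∀ᶠ N in Filter.atTop, ∀ D : Literature.Analysis.FluidPDE.Config (N + 1) (Fin 3) Literature.MathematicalPhysics.KineticTheory.T3 → ℝ, D = (fun z => ((N + 1 : ℕ) : ℝ)⁻¹ * (∫ s in t₁..t₂, Literature.Analysis.FluidPDE.momentumStreaming φ ((Φ N).flow s z)) - ∫ s in t₁..t₂, ∫ x, ((N + 1 : ℕ) : ℝ)⁻¹ * ∑ a, k (x - ((Φ N).flow s z a).1) * (∑ i, ∑ j, ((Φ N).flow s z a).2 i * ((Φ N).flow s z a).2 j * Literature.Analysis.FunctionSpaces.Torus.partialDeriv j (fun y => φ y i) x)) → MeasureTheory.Integrable D (Literature.MathematicalPhysics.KineticTheory.localGibbsLaw σ a₀ u₀ θ₀ N (Φ N)) ∧ |∫ z, D z ∂Literature.MathematicalPhysics.KineticTheory.localGibbsLaw σ a₀ u₀ θ₀ N (Φ N)| ≤ ε) := by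
  intro a₀ θ₀ u₀ ha hθ hu ha0 hθ0
  refine ⟨1 / 2, by norm_num, ?_⟩
  intro σ _hσ hσlt Φ t₁ t₂ h₁ h₁₂ ε hε φ hφ
  -- a bound `B₁` on `3θ₀ + ‖u₀‖²`, the mean of `(N+1)⁻¹ Σ ‖v_a‖²`
  obtain ⟨Θ, hΘ0, hΘ⟩ := exists_forall_abs_le_of_continuous hθ
  obtain ⟨U, -, hU⟩ := exists_forall_abs_le_of_continuous (continuous_norm.comp hu)
  have hB₁ : ∀ x, 3 * θ₀ x + ‖u₀ x‖ ^ 2 ≤ 3 * Θ + U ^ 2 := fun x => by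
    have h1 : θ₀ x ≤ Θ := (le_abs_self _).trans (hΘ x)
    have h2 : ‖u₀ x‖ ^ 2 ≤ U ^ 2 :=
      pow_le_pow_left₀ (norm_nonneg _) ((le_abs_self _).trans (hU x)) 2
    linarith
  have hB₁0 : 0 ≤ 3 * Θ + U ^ 2 := by positivity
  -- the tolerance `η` of the mollified partial derivatives
  set η : ℝ := ε / (9 * (t₂ - t₁ + 1) * (3 * Θ + U ^ 2 + 1)) with hηdef
  have hT0 : 0 < t₂ - t₁ + 1 := by linarith
  have hη0 : 0 < η := div_pos hε (by positivity)
  have hηε : 9 * η * (t₂ - t₁) * (3 * Θ + U ^ 2) ≤ ε := by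
    have hden : 0 < 9 * (t₂ - t₁ + 1) * (3 * Θ + U ^ 2 + 1) := by positivity
    calc 9 * η * (t₂ - t₁) * (3 * Θ + U ^ 2)
        ≤ 9 * η * (t₂ - t₁ + 1) * (3 * Θ + U ^ 2 + 1) := by
          have h9η : 0 ≤ 9 * η := by positivity
          exact mul_le_mul (mul_le_mul_of_nonneg_left (by linarith) h9η) (by linarith) hB₁0
            (mul_nonneg h9η hT0.le)
      _ = ε := by
          rw [hηdef]
          field_simp
  -- uniform continuity of the matrix of partial derivatives `∂ⱼφᵢ` in the minimal-image distance
  set P : T3 → Fin 3 → Fin 3 → ℝ := fun x i j => Torus.partialDeriv j (fun y => φ y i) x with hPdef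
  have hPc : Continuous P :=
    continuous_pi fun i => continuous_pi fun j => continuous_partialDeriv_apply hφ i j
  obtain ⟨δ, hδ, hδP⟩ := MesoLLN.exists_forall_euclidDist_lt_norm_sub_lt hPc hη0
  refine ⟨δ, hδ, fun k hk => Eventually.of_forall fun N => ?_⟩
  obtain ⟨hkc, hk0, hk1, hksupp⟩ := hk
  have hsupp : ∀ y, δ ≤ Torus.euclidDist y 0 → k y = 0 := fun y hy => by
    by_contra h
    exact (not_lt.2 hy) (hksupp y h)
  have hηP : ∀ i j (p : T3), |(∫ x, k (x - p) * Torus.partialDeriv j (fun y => φ y i) x) -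
      Torus.partialDeriv j (fun y => φ y i) p| ≤ η := by
    intro i j p
    refine MesoLLN.abs_integral_translate_mul_sub_le hkc hk0 hk1 hsupp
      (continuous_partialDeriv_apply hφ i j) (fun x y hxy => ?_) p
    calc |Torus.partialDeriv j (fun y => φ y i) y - Torus.partialDeriv j (fun y => φ y i) x|
        = |P y i j - P x i j| := rfl
      _ ≤ ‖P y - P x‖ := abs_sub_apply_le_norm_sub _ _ i j
      _ ≤ η := (hδP y x hxy).le
  -- the law: a probability measure carried by the good set
  intro D hD
  set μ := localGibbsLaw σ a₀ u₀ θ₀ N (Φ N) with hμ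
  have hprob : IsProbabilityMeasure μ :=
    isProbabilityMeasure_localGibbsLaw ha hθ hu ha0 hθ0 hσlt.le N (Φ N)
  have hPac : μ ≪ liouville (Torus.geometry (Fin 3)) (N + 1) (hsDiameter σ N) := by
    rw [hμ, localGibbsLaw_eq]
    exact localGibbsMeasure_absolutelyContinuous σ a₀ u₀ θ₀ N (Φ N)
  have hgood : ∀ᵐ z ∂μ, z ∈ (Φ N).good := hPac.ae_le (Φ N).ae_mem_good
  have hgood' : μ (Φ N).goodᶜ = 0 := hPac (Φ N).measure_compl_good
  set c : ℝ := ((N + 1 : ℕ) : ℝ)⁻¹ with hcdef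
  have hc : 0 ≤ c := inv_nonneg.2 (Nat.cast_nonneg _)
  -- the dominating energy functional, integrable with mean `≤ B₁`
  have hEint : Integrable (fun z : Config (N + 1) (Fin 3) T3 => c * ∑ a, ‖(z a).2‖ ^ 2) μ := by
    have h := RestartPrinciple.AgeDuhamelForgetting.integrable_avg_norm_sq_vel_flow (Φ N) ha hθ hu
      (fun x => (ha0 x).le) hθ0 hprob 0
    refine h.congr ?_
    filter_upwards [hgood] with z hz
    rw [(Φ N).flow_zero z hz]
  have hEmean : ∫ z, c * ∑ a, ‖(z a).2‖ ^ 2 ∂μ ≤ 3 * Θ + U ^ 2 := by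
    haveI : IsProbabilityMeasure (particleLaw (Φ N) (canonicalDensity (Torus.geometry (Fin 3))
        (hsDiameter σ N) (N + 1) (localGibbsProfile a₀ u₀ θ₀))) := hprob
    have hlin : ∫⁻ z, ENNReal.ofReal (c * ∑ a, ‖(z a).2‖ ^ 2) ∂μ ≤ ENNReal.ofReal (3 * Θ + U ^ 2) :=
      NearConstantShortTimeHL.lintegral_avg_norm_sq_vel_le (Φ N) ha hθ hu (fun x => (ha0 x).le)
        hθ0 hB₁
    rw [integral_eq_lintegral_of_nonneg_ae (ae_of_all _ fun z =>
      mul_nonneg hc (Finset.sum_nonneg fun a _ => sq_nonneg _)) hEint.aestronglyMeasurable]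
    exact ENNReal.toReal_le_of_le_ofReal hB₁0 hlin
  -- measurability of the functional (window integrals of measurable observables along the flow)
  have hφ1 : Torus.IsContDiff 1 φ := hφ.isContDiff (by simp)
  have hI₁ : AEMeasurable (fun z => ∫ s in t₁..t₂, momentumStreaming φ ((Φ N).flow s z)) μ :=
    (Φ N).aemeasurable_intervalIntegral_comp_flow_torus
      (continuous_momentumStreaming hφ1).measurable t₁ t₂ hgood'
  have hI₂ : AEMeasurable (fun z => ∫ s in t₁..t₂, ∫ x, c * ∑ a, k (x - ((Φ N).flow s z a).1) *
      (∑ i, ∑ j, ((Φ N).flow s z a).2 i * ((Φ N).flow s z a).2 j *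
        Torus.partialDeriv j (fun y => φ y i) x)) μ :=
    (Φ N).aemeasurable_intervalIntegral_comp_flow_torus
      (f := fun w => ∫ x, c * ∑ a, k (x - (w a).1) *
        (∑ i, ∑ j, (w a).2 i * (w a).2 j * Torus.partialDeriv j (fun y => φ y i) x))
      (continuous_mollifiedStress hφ hkc c).measurable t₁ t₂ hgood'
  have hDm : AEStronglyMeasurable D μ := by
    rw [hD]
    exact ((hI₁.const_mul c).sub hI₂).aestronglyMeasurable
  -- the pathwise bound, almost surely
  have hDle : ∀ᵐ z ∂μ, ‖D z‖ ≤ 9 * η * (t₂ - t₁) * (c * ∑ a, ‖(z a).2‖ ^ 2) := by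
    filter_upwards [hgood] with z hz
    rw [hD, Real.norm_eq_abs]
    exact abs_window_commutator_le (Φ N) hφ hkc hηP hc hz h₁ h₁₂
  have hDint : Integrable D μ := Integrable.mono' (hEint.const_mul _) hDm hDle
  refine ⟨hDint, ?_⟩
  have h9 : 0 ≤ 9 * η * (t₂ - t₁) := by
    have : 0 ≤ t₂ - t₁ := sub_nonneg.2 h₁₂
    positivity
  calc |∫ z, D z ∂μ| ≤ ∫ z, |D z| ∂μ := abs_integral_le_integral_abs
    _ ≤ ∫ z, 9 * η * (t₂ - t₁) * (c * ∑ a, ‖(z a).2‖ ^ 2) ∂μ := by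
        refine integral_mono_ae hDint.abs (hEint.const_mul _) ?_
        filter_upwards [hDle] with z hz
        rwa [Real.norm_eq_abs] at hz
    _ = 9 * η * (t₂ - t₁) * ∫ z, c * ∑ a, ‖(z a).2‖ ^ 2 ∂μ := integral_const_mul _ _
    _ ≤ 9 * η * (t₂ - t₁) * (3 * Θ + U ^ 2) := mul_le_mul_of_nonneg_left hEmean h9
    _ ≤ ε := hηε

end Summit.AtomisticToContinuum.HydrodynamicLimit.Theorems

end
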